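/-
Copyright (c) 2026 the pub-hodgecm-mathlib formalisation cell (harness21).  Prover seat hodgecm-mathlib-K2E4-p11 (g3), Track B ∕ K2-LIT, h413 =
`stmt-HodgeConjecture-24833`, campaign «EIS-RANK-ONE» rung R6f «AVG»; DEAL BY NAME of the dealer K2E1-plan (g3) 2026-09-04T05:25:41Z (2) (design K2E1-p09 (g4)).
-/
import Summits.HodgeConjecture.HodgeConjecture.Theorems.K2E1IntertwiningAdjoint          -- ★ p857605: letters `Γ_B = Γ_T ⋉ Γ_N`, `hconj` discharges ★ p857500, engine ★ p857571
import Literature.NumberTheory.Automorphic.UnitaryGroupBorelTruncation                       -- Track A `borelConstantTerm`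
import HarnessLib

/-!
# K2·E1 — `K2E1BorelWeightAverage` (rung R6f, «AVG»): THE CONSTANT-TERM AVERAGE UNDER A `B(F)♯`-COVERING WEIGHT IS FREE —
# `∫ (β g) • (F)_B(g) dν_G = ∫ (β g) • F(g) dν_G` for left-`B(F)`-invariant `F`, hence `[ψ, CT Λ']_β = [ψ, Λ']_β`

Track B ∕ K2-LIT, crux h413 = `stmt-HodgeConjecture-24833`, route of record `HCCMUnconditional`; cell `hodgecm-mathlib`, squad K2, ENGINE E1, campaign EIS-RANK-ONE
(SPEC `SPEC-EIS-R6-MaassSelberg` §2′, dealer K2E1-plan (g3) 05:14:03Z (i) ∕ 05:25:41Z (2), design of K2E1-p09 (g4)).  Prover seat `hodgecm-mathlib-K2E4-p11` (g3).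
THEOREMS ONLY (no `def`, no `instance`, no notation, no named-fact hypothesis, no `sorry`); lane `--kind proof --supports stmt-HodgeConjecture-24833 --as helper`
(count-neutral, closes no socket).  OUTPUT = the discharge of the named input `hAVG : [ψ, Λ']_β = [ψ, CT']_β` of ★ p857577∕p857614 `K2E1MaassSelberg(FourBrackets∕U)`.

SETTING.  `G = U(J_N)` quasi-split over a quadratic `E/F`; `ν_G` a Haar measure on `G(𝔸)`; `ν_N` a Haar measure on `N(𝔸) = adelicUnipotent F E c N`, inversion-invariant, and
invariant under conjugation by `B(F)` (`hconj`: the product formula ★ p857500 `map_conj_toAdelic_eq_self_three∕_two`, discharged in §4); `𝓕 ⊆ N(𝔸)` a fundamental domain of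
`N(F) = rationalUnipotent` with `0 < ν_N(𝓕) < ∞`; `β` a covering weight of `B(F)♯ = (arithmeticBorel).map (arithmeticSubgroup).subtype` on `G(𝔸)` (★ BochnerFin token);
Track A's constant term `F_B(g) = borelConstantTerm ν_N 𝓕 F g = (ν_N 𝓕)⁻¹ • ∫_{𝓕} F(u g) dν_N` (`UnitaryGroupBorelTruncation`).
* §1 (AVG-1) **THE `𝓕`-FIBRE WEIGHT `B_𝓕(g) = ∫⁻_{𝓕} β(u⁻¹ g) dν_N` HAS `B(F)♯`-COVERING SUM `ν_N(𝓕)`** (`coveringSum_fibreWeight_restrict_eq_of`): order `Γ_B ∋ γ = n·t`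
  (the ★ equivalence `Γ_T × Γ_N ≃ Γ_B`, `e(t,n) = t n`, conjugated by inversions), unfold `Σ_{n ∈ N(F)} ∫_{𝓕} = ∫_{N(𝔸)}` (Mathlib `IsFundamentalDomain.lintegral_eq_tsum''`), then ★ (E2)
  `coveringSum_fibreWeight_eq` (`Σ_{t ∈ T(F)♯} ∫⁻_{N(𝔸)} β(u⁻¹ t g) = ν_N(𝓕)`).
* §2 (AVG-2∕3) **THE AVERAGE IS FREE** (`integral_wt_smul_borelConstantTerm_eq_of`): for measurable left-`B(F)`-invariant `F : G(𝔸) → ℂ` with `∫⁻ β ‖F‖ dν_G < ∞`: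
  `∫ (β g).toReal • F_B(g) dν_G = ∫ (β g).toReal • F(g) dν_G` — ★ (E1) `integral_wt_smul_integral_translate` with `μ_U := ν_N|_{𝓕}` turns the left side into
  `(ν_N 𝓕)⁻¹ ∫ wt B_𝓕 • F`, and Bochner weight independence (★ `integral_wt_smul_eq_of_coveringSum_eq_one` for the two `B(F)♯`-weights `(ν_N 𝓕)⁻¹ B_𝓕` and `β`, §1) finishes;
  the `L¹` hypothesis transfers (★ `lintegral_enorm_mul_eq_of_coveringSum_eq_one`, ★ (E1c)).
* §3 (AVG-4) **PULL-OUT** `(ψ · conj Λ')_B = ψ · conj (Λ')_B` for left-`N(𝔸)`-invariant `ψ` (`borelConstantTerm_mul_conj_of_unipotent_invariant`), and the corollary in the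
  exact shape of `hAVG`: `∫ (β g).toReal • (ψ g * conj (Λ' g)) dν_G = ∫ (β g).toReal • (ψ g * conj ((Λ')_B g)) dν_G` (`integral_wt_smul_mul_conj_eq_mul_conj_borelConstantTerm_of`).
* §4 the `U(J₃)` ∕ `U(J₂)` instances (`c² = 1`, `c ≠ 1`; `hconj` by ★ p857500).
[MoeglinWaldspurger1995, II.1.7–II.1.8 (the constant term is the orthogonal projection in the unfolded pairing), IV.2; Garrett2018, §1.10 («the two unwindings»);
Arthur1980TraceFormulaII, §4.]

HONEST LABEL: HC_CM is proved only modulo the 7 printed citations (2 remaining named inputs: hLiu418 = `stmt-HodgeConjecture-24832`, h413 = `stmt-HodgeConjecture-24833`) until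
rung 0 closes; count-neutral helper, closes no socket.

## References
* [MoeglinWaldspurger1995] C. Mœglin, J.-L. Waldspurger, *Spectral Decomposition and Eisenstein Series* (1995), II.1.7–II.1.8, IV.2.
* [Garrett2018] P. Garrett, *Modern Analysis of Automorphic Forms by Example* (2018), §1.10–1.11.
* [Rogawski1990] J. D. Rogawski, *Automorphic Representations of Unitary Groups in Three Variables*, Ann. of Math. Stud. 123 (1990), §2.1 (`φ_P`).
-/

set_option autoImplicit false
-- the mandated namespace repeats the single-problem summit's segment (`HodgeConjecture.HodgeConjecture`)
set_option linter.dupNamespace false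

noncomputable section

open MeasureTheory MeasureTheory.Measure Set NumberField IsDedekindDomain
open scoped ENNReal NNReal
open Literature.MeasureTheory.Group Literature.NumberTheory
open Literature.NumberTheory.Automorphic Literature.NumberTheory.Automorphic.UnitaryGroup
open Summit.HodgeConjecture.HodgeConjecture.Cruxes.H413.K2E1IntertwiningAdjointEngine
open Summit.HodgeConjecture.HodgeConjecture.Cruxes.H413.K2E1IntertwiningAdjoint
open Summit.HodgeConjecture.HodgeConjecture.Cruxes.H413.K2E1IntertwinedSectionInvariance

namespace Summit.HodgeConjecture.HodgeConjecture.Cruxes.H413.K2E1BorelWeightAverage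

variable {F E : Type} [Field F] [NumberField F] [Field E] [NumberField E] [Algebra F E] {c : E ≃ₐ[F] E} {N : ℕ}

section Generic

variable [MeasurableSpace (quasiSplit F E c N).Adelic] [BorelSpace (quasiSplit F E c N).Adelic]

/-! ## §1 (AVG-1) The `𝓕`-fibre weight has `B(F)♯`-covering sum `ν_N(𝓕)` -/

/-- **(AVG-1) THE COVERING SUM OF THE `𝓕`-FIBRE WEIGHT.**  `ν_N` inversion-invariant Haar on `N(𝔸)`, invariant under conjugation by `B(F)` (`hconj`), `𝓕` a fundamental domain of
`N(F)`, `β` a covering weight of `B(F)♯`.  Then for every `g ∈ G(𝔸)`: `Σ_{γ ∈ B(F)♯} ∫⁻_{u ∈ 𝓕} β(u⁻¹ γ g) dν_N = ν_N(𝓕)` — write `γ = n t` (the ★ equivalence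
`exists_equiv_torus_prod_rationalUnipotent` twisted by inversions), `Σ_{n ∈ N(F)} ∫⁻_{𝓕} β(u⁻¹ n t g) = ∫⁻_{N(𝔸)} β(u⁻¹ t g)` (`IsFundamentalDomain.lintegral_eq_tsum''` for
`u ↦ β(u⁻¹ t g)`), and ★ (E2) `coveringSum_fibreWeight_eq`. [cite: MoeglinWaldspurger1995, II.1.8] [cite: Garrett2018, §1.10] -/
theorem coveringSum_fibreWeight_restrict_eq_of
    (νN : Measure ↥(adelicUnipotent F E c N)) [νN.IsHaarMeasure] [νN.IsInvInvariant]
    (hconj : ∀ b₀ (hb₀ : b₀ ∈ borelU (c : E →+* E) ((StdForm.antidiagonal N).over E)),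
      νN.map (fun v : ↥(adelicUnipotent F E c N) => (⟨((quasiSplit F E c N).toAdelic b₀)⁻¹ * (v : (quasiSplit F E c N).Adelic) * (quasiSplit F E c N).toAdelic b₀,
        conj_mem_adelicUnipotent ((K2E1PseudoEisensteinConstantTermU.toAdelic_mem_borelAdelic_iff b₀).2 hb₀) v.2⟩ : ↥(adelicUnipotent F E c N))) = νN)
    {𝓕 : Set ↥(adelicUnipotent F E c N)} (h𝓕 : IsFundamentalDomain ↥(rationalUnipotent F E c N) 𝓕 νN)
    {β : (quasiSplit F E c N).Adelic → ℝ≥0∞} (hβ : IsCoveringWeight ↥((arithmeticBorel F E c N).map (quasiSplit F E c N).arithmeticSubgroup.subtype) β)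
    (g : (quasiSplit F E c N).Adelic) :
    coveringSum ↥((arithmeticBorel F E c N).map (quasiSplit F E c N).arithmeticSubgroup.subtype)
      (fun y => ∫⁻ u in 𝓕, β (((u : (quasiSplit F E c N).Adelic))⁻¹ * y) ∂νN) g = νN 𝓕 := by
  classical
  haveI := secondCountableTopology_adeleRing E
  haveI := locallyCompactSpace_adeleRing' E
  haveI : SecondCountableTopology (quasiSplit F E c N).Adelic := inferInstanceAs (SecondCountableTopology (adelic F E c N ((StdForm.antidiagonal N).over E)))
  haveI : SecondCountableTopology ↥(adelicUnipotent F E c N) := TopologicalSpace.Subtype.secondCountableTopology _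
  haveI := countable_mapTorus (F := F) (E := E) (c := c) (N := N)
  haveI := countable_rationalUnipotent' (F := F) (E := E) (c := c) (N := N)
  haveI := K2E1IntertwiningAdjointEngine.measurableConstSMul_subgroup (rationalUnipotent F E c N)
  haveI := K2E1IntertwiningAdjointEngine.smulInvariantMeasure_subgroup (rationalUnipotent F E c N) νN
  have hβm := hβ.measurable
  obtain ⟨e, he⟩ := exists_equiv_torus_prod_rationalUnipotent (F := F) (E := E) (c := c) (N := N)
  -- conjugation by `T(F)♯` preserves `N(𝔸)` and `ν_N` (as in ★ p857605)
  have htU : ∀ t ∈ (torusU (c : E →+* E) ((StdForm.antidiagonal N).over E)).map (quasiSplit F E c N).toAdelic, ∀ u : ↥(adelicUnipotent F E c N),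
      t⁻¹ * (u : (quasiSplit F E c N).Adelic) * t ∈ adelicUnipotent F E c N := fun t ht u => by
    obtain ⟨t₀, ht₀, rfl⟩ := mem_mapTorus_iff.1 ht
    exact conj_mem_adelicUnipotent ((K2E1PseudoEisensteinConstantTermU.toAdelic_mem_borelAdelic_iff t₀).2 (torusU_le_borelU _ _ ht₀)) u.2
  have hconj' : ∀ (t : (quasiSplit F E c N).Adelic) (ht : t ∈ (torusU (c : E →+* E) ((StdForm.antidiagonal N).over E)).map (quasiSplit F E c N).toAdelic)
      (f : ↥(adelicUnipotent F E c N) → ℝ≥0∞), Measurable f →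
        ∫⁻ u, f ⟨t⁻¹ * (u : (quasiSplit F E c N).Adelic) * t, htU t ht u⟩ ∂νN = ∫⁻ u, f u ∂νN := by
    intro t ht f hf
    obtain ⟨t₀, ht₀, ht⟩ := mem_mapTorus_iff.1 ht
    subst ht
    have hκ : Measurable fun u : ↥(adelicUnipotent F E c N) =>
        (⟨((quasiSplit F E c N).toAdelic t₀)⁻¹ * (u : (quasiSplit F E c N).Adelic) * (quasiSplit F E c N).toAdelic t₀, htU _ ht u⟩ : ↥(adelicUnipotent F E c N)) :=
      ((measurable_subtype_coe.const_mul _).mul_const _).subtype_mk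
    rw [← lintegral_map hf hκ, hconj t₀ (torusU_le_borelU _ _ ht₀)]
  have hV := coveringSum_fibreWeight_eq (adelicUnipotent F E c N) νN ((arithmeticBorel F E c N).map (quasiSplit F E c N).arithmeticSubgroup.subtype)
    ((torusU (c : E →+* E) ((StdForm.antidiagonal N).over E)).map (quasiSplit F E c N).toAdelic) (rationalUnipotent F E c N) e he h𝓕 htU hconj' hβ g
  -- the equivalence read in the order `n · t`: `e'(t, n) = (e(t⁻¹, n⁻¹))⁻¹ = n t`
  set e' : ↥((torusU (c : E →+* E) ((StdForm.antidiagonal N).over E)).map (quasiSplit F E c N).toAdelic) × ↥(rationalUnipotent F E c N) ≃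
      ↥((arithmeticBorel F E c N).map (quasiSplit F E c N).arithmeticSubgroup.subtype) :=
    ((Equiv.inv _).prodCongr (Equiv.inv _)).trans (e.trans (Equiv.inv _)) with he'def
  have he' : ∀ t n, ((e' (t, n) : ↥((arithmeticBorel F E c N).map (quasiSplit F E c N).arithmeticSubgroup.subtype)) : (quasiSplit F E c N).Adelic) =
      ((n : ↥(adelicUnipotent F E c N)) : (quasiSplit F E c N).Adelic) * (t : (quasiSplit F E c N).Adelic) := by
    intro t n
    simp only [he'def, Equiv.trans_apply, Equiv.prodCongr_apply, Equiv.inv_apply, Prod.map_apply, Subgroup.coe_inv, he, mul_inv_rev,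
      inv_inv]
  rw [coveringSum_apply, ← e'.tsum_eq, ENNReal.tsum_prod']
  rw [coveringSum_apply] at hV
  rw [← hV]
  refine tsum_congr fun t => ?_
  -- `Σ_n ∫⁻_{𝓕} β(u⁻¹ n t g) = ∫⁻_{N(𝔸)} β(u⁻¹ t g)`
  have hunf := h𝓕.lintegral_eq_tsum'' fun u : ↥(adelicUnipotent F E c N) => β (((u : (quasiSplit F E c N).Adelic))⁻¹ * (t • g))
  rw [hunf, ← (Equiv.inv ↥(rationalUnipotent F E c N)).tsum_eq]
  refine tsum_congr fun n => ?_
  refine lintegral_congr fun v => ?_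
  simp only [Equiv.inv_apply, Subgroup.smul_def, smul_eq_mul, he', Subgroup.coe_inv, Subgroup.coe_mul, mul_inv_rev]
  congr 1
  simp only [mul_assoc]

/-! ## §2 (AVG-2∕3) The constant-term average is free under a `B(F)♯`-weight -/

/-- **(AVG) `∫ (β g) • F_B(g) dν_G = ∫ (β g) • F(g) dν_G`.**  `ν_G` Haar on `G(𝔸)`; `ν_N`, `𝓕`, `hconj`, `β` as in §1 with `0 < ν_N(𝓕) < ∞`; `F : G(𝔸) → ℂ` measurable, left-`B(F)`-invariant, with
`∫⁻ β ‖F‖ dν_G < ∞`.  Then the Borel constant term `F_B = borelConstantTerm ν_N 𝓕 F` integrates like `F` against the weight: ★ (E1) (`μ_U := ν_N|_𝓕`) + weight independence of the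
`B(F)♯`-weights `(ν_N 𝓕)⁻¹ B_𝓕` (§1) and `β` (★ `integral_wt_smul_eq_of_coveringSum_eq_one`). [cite: MoeglinWaldspurger1995, II.1.8] [cite: Garrett2018, §1.10] -/
theorem integral_wt_smul_borelConstantTerm_eq_of
    (νG : Measure (quasiSplit F E c N).Adelic) [νG.IsHaarMeasure]
    (νN : Measure ↥(adelicUnipotent F E c N)) [νN.IsHaarMeasure] [νN.IsInvInvariant]
    (hconj : ∀ b₀ (hb₀ : b₀ ∈ borelU (c : E →+* E) ((StdForm.antidiagonal N).over E)),
      νN.map (fun v : ↥(adelicUnipotent F E c N) => (⟨((quasiSplit F E c N).toAdelic b₀)⁻¹ * (v : (quasiSplit F E c N).Adelic) * (quasiSplit F E c N).toAdelic b₀,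
        conj_mem_adelicUnipotent ((K2E1PseudoEisensteinConstantTermU.toAdelic_mem_borelAdelic_iff b₀).2 hb₀) v.2⟩ : ↥(adelicUnipotent F E c N))) = νN)
    {𝓕 : Set ↥(adelicUnipotent F E c N)} (h𝓕 : IsFundamentalDomain ↥(rationalUnipotent F E c N) 𝓕 νN) (h𝓕₀ : νN 𝓕 ≠ 0) (h𝓕top : νN 𝓕 ≠ ∞)
    {β : (quasiSplit F E c N).Adelic → ℝ≥0∞} (hβ : IsCoveringWeight ↥((arithmeticBorel F E c N).map (quasiSplit F E c N).arithmeticSubgroup.subtype) β)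
    {Fn : (quasiSplit F E c N).Adelic → ℂ} (hFm : Measurable Fn)
    (hFB : ∀ b ∈ arithmeticBorel F E c N, ∀ x : (quasiSplit F E c N).Adelic, Fn ((b : (quasiSplit F E c N).Adelic) * x) = Fn x)
    (hL1 : ∫⁻ g, β g * ‖Fn g‖ₑ ∂νG < ∞) :
    ∫ g, (β g).toReal • borelConstantTerm νN 𝓕 Fn g ∂νG = ∫ g, (β g).toReal • Fn g ∂νG := by
  classical
  haveI := secondCountableTopology_adeleRing E
  haveI := locallyCompactSpace_adeleRing' E
  haveI := t2Space_adeleRing_of_numberField E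
  haveI : SecondCountableTopology (quasiSplit F E c N).Adelic := inferInstanceAs (SecondCountableTopology (adelic F E c N ((StdForm.antidiagonal N).over E)))
  haveI : LocallyCompactSpace (quasiSplit F E c N).Adelic := inferInstanceAs (LocallyCompactSpace (adelic F E c N ((StdForm.antidiagonal N).over E)))
  haveI : SecondCountableTopology ↥(adelicUnipotent F E c N) := TopologicalSpace.Subtype.secondCountableTopology _
  have hNcl : IsClosed ((adelicUnipotent F E c N : Set (quasiSplit F E c N).Adelic)) := by
    change IsClosed (⇑(adelicVal F E c N ((StdForm.antidiagonal N).over E)) ⁻¹'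
      ((upperUnitriangular (Fin N) (AdeleRing (𝓞 E) E) : Subgroup (GL (Fin N) (AdeleRing (𝓞 E) E))) : Set (GL (Fin N) (AdeleRing (𝓞 E) E))))
    exact (isClosed_upperUnitriangular (R := AdeleRing (𝓞 E) E)).preimage continuous_subtype_val
  haveI : LocallyCompactSpace ↥(adelicUnipotent F E c N) := hNcl.locallyCompactSpace
  haveI : SFinite (νN.restrict 𝓕) := inferInstance
  haveI : Countable ↥((arithmeticBorel F E c N).map (quasiSplit F E c N).arithmeticSubgroup.subtype) := by
    obtain ⟨e, -⟩ := exists_equiv_torus_prod_rationalUnipotent (F := F) (E := E) (c := c) (N := N)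
    haveI := countable_mapTorus (F := F) (E := E) (c := c) (N := N)
    haveI := countable_rationalUnipotent' (F := F) (E := E) (c := c) (N := N)
    exact Countable.of_equiv _ e
  haveI := K2E1IntertwiningAdjointEngine.measurableConstSMul_subgroup ((arithmeticBorel F E c N).map (quasiSplit F E c N).arithmeticSubgroup.subtype)
  haveI := K2E1IntertwiningAdjointEngine.smulInvariantMeasure_subgroup ((arithmeticBorel F E c N).map (quasiSplit F E c N).arithmeticSubgroup.subtype) νG
  have hβm := hβ.measurable
  have hβfin : ∀ g, β g ≠ ∞ := fun g => ne_top_of_le_ne_top ENNReal.one_ne_top (hβ.le_one g)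
  -- the `𝓕`-fibre weight `B(y) = ∫⁻_{𝓕} β(u⁻¹ y)` and its normalisation
  set μU : Measure ↥(adelicUnipotent F E c N) := νN.restrict 𝓕 with hμU
  set B : (quasiSplit F E c N).Adelic → ℝ≥0∞ := fun y => ∫⁻ u, β (((u : (quasiSplit F E c N).Adelic))⁻¹ * y) ∂μU with hBdef
  have hBm : Measurable B := measurable_fibreWeight (adelicUnipotent F E c N) μU hβm
  have hBsum : ∀ y, coveringSum ↥((arithmeticBorel F E c N).map (quasiSplit F E c N).arithmeticSubgroup.subtype) B y = νN 𝓕 :=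
    fun y => coveringSum_fibreWeight_restrict_eq_of νN hconj h𝓕 hβ y
  have hV0 : (νN 𝓕)⁻¹ ≠ 0 := ENNReal.inv_ne_zero.2 h𝓕top
  have hVt : (νN 𝓕)⁻¹ ≠ ∞ := ENNReal.inv_ne_top.2 h𝓕₀
  have h₁ : ∀ y, coveringSum ↥((arithmeticBorel F E c N).map (quasiSplit F E c N).arithmeticSubgroup.subtype) (fun y => (νN 𝓕)⁻¹ * B y) y = 1 := fun y => by
    rw [coveringSum_const_mul, hBsum, ENNReal.inv_mul_cancel h𝓕₀ h𝓕top]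
  have hFinv : ∀ (γ : ↥((arithmeticBorel F E c N).map (quasiSplit F E c N).arithmeticSubgroup.subtype)) (x : (quasiSplit F E c N).Adelic), Fn (γ • x) = Fn x := by
    rintro ⟨_, ⟨b, hb, rfl⟩⟩ x
    exact hFB b hb x
  -- `L¹` against the normalised fibre weight (= `L¹` against `β`)
  have hB1m : Measurable fun y => (νN 𝓕)⁻¹ * B y := measurable_const.mul hBm
  have hL1' : ∫⁻ g, ‖Fn g‖ₑ * ((νN 𝓕)⁻¹ * B g) ∂νG < ∞ := by
    rw [lintegral_enorm_mul_eq_of_coveringSum_eq_one νG hFm.stronglyMeasurable hFinv (β₁ := fun y => (νN 𝓕)⁻¹ * B y) (β₂ := β)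
      hB1m hβm h₁ hβ.coveringSum_eq]
    calc ∫⁻ g, ‖Fn g‖ₑ * β g ∂νG = ∫⁻ g, β g * ‖Fn g‖ₑ ∂νG := lintegral_congr fun g => mul_comm _ _
      _ < ∞ := hL1
  -- the absolute-convergence hypothesis of (E1): `∫⁻ β ∫⁻_{μU} ‖F(u ·)‖ = ∫⁻ ‖F‖ B < ∞`
  have hint : ∫⁻ g, β g * ∫⁻ u, ‖Fn ((u : (quasiSplit F E c N).Adelic) * g)‖ₑ ∂μU ∂νG < ∞ := by
    rw [← lintegral_enorm_mul_fibreWeight_eq νG (adelicUnipotent F E c N) μU hβm hFm]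
    have h : ∫⁻ g, ‖Fn g‖ₑ * B g ∂νG = νN 𝓕 * ∫⁻ g, ‖Fn g‖ₑ * ((νN 𝓕)⁻¹ * B g) ∂νG := by
      have hm : Measurable fun g => ‖Fn g‖ₑ * ((νN 𝓕)⁻¹ * B g) := hFm.enorm.mul hB1m
      rw [← lintegral_const_mul _ hm]
      refine lintegral_congr fun g => ?_
      rw [← mul_assoc, mul_comm (νN 𝓕), mul_assoc, ← mul_assoc (νN 𝓕), ENNReal.mul_inv_cancel h𝓕₀ h𝓕top, one_mul]
    rw [h]
    exact ENNReal.mul_lt_top h𝓕top.lt_top hL1'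
  -- (E1): `∫ wt β • (∫_{μU} F(u g)) = ∫ wt B • F`
  have hE1 := integral_wt_smul_integral_translate νG (adelicUnipotent F E c N) μU hβm hβfin hFm hint
  -- weight independence: `∫ wt ((ν 𝓕)⁻¹ B) • F = ∫ wt β • F`
  have hWI := integral_wt_smul_eq_of_coveringSum_eq_one νG hFm.stronglyMeasurable hFinv (β₁ := fun y => (νN 𝓕)⁻¹ * B y) (β₂ := β)
    hB1m hβm h₁ hβ.coveringSum_eq hL1'
  -- assemble
  calc ∫ g, (β g).toReal • borelConstantTerm νN 𝓕 Fn g ∂νG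
      = ∫ g, ((νN 𝓕).toReal⁻¹ : ℝ) • ((β g).toReal • ∫ u, Fn ((u : (quasiSplit F E c N).Adelic) * g) ∂μU) ∂νG := by
        refine integral_congr_ae (ae_of_all _ fun g => ?_)
        simp only [borelConstantTerm_def, hμU, smul_comm ((β g).toReal)]
    _ = ((νN 𝓕).toReal⁻¹ : ℝ) • ∫ g, (B g).toReal • Fn g ∂νG := by rw [integral_smul, hE1]
    _ = ∫ g, ((νN 𝓕)⁻¹ * B g).toReal • Fn g ∂νG := by
        rw [← integral_smul]
        refine integral_congr_ae (ae_of_all _ fun g => ?_)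
        simp only [ENNReal.toReal_mul, ENNReal.toReal_inv, smul_smul]
    _ = ∫ g, (β g).toReal • Fn g ∂νG := hWI

/-! ## §3 (AVG-4) Pull-out and the `hAVG` shape -/

omit [BorelSpace (quasiSplit F E c N).Adelic] in
/-- **(AVG-4) PULL-OUT.**  For `ψ` left-`N(𝔸)`-invariant: `(ψ · conj Λ')_B(g) = ψ(g) · conj ((Λ')_B(g))` (`conj` is a real-linear isometry, `integral_conj`). [cite: Rogawski1990, §2.1] -/
theorem borelConstantTerm_mul_conj_of_unipotent_invariant (νN : Measure ↥(adelicUnipotent F E c N)) (𝓕 : Set ↥(adelicUnipotent F E c N))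
    {ψ Λ' : (quasiSplit F E c N).Adelic → ℂ}
    (hψN : ∀ (u : ↥(adelicUnipotent F E c N)) (g : (quasiSplit F E c N).Adelic), ψ ((u : (quasiSplit F E c N).Adelic) * g) = ψ g)
    (g : (quasiSplit F E c N).Adelic) :
    borelConstantTerm νN 𝓕 (fun y => ψ y * (starRingEnd ℂ) (Λ' y)) g = ψ g * (starRingEnd ℂ) (borelConstantTerm νN 𝓕 Λ' g) := by
  simp only [borelConstantTerm_def, hψN]
  rw [integral_const_mul, integral_conj]
  simp only [Complex.real_smul, map_mul, Complex.conj_ofReal]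
  ring

/-- **THE `hAVG` SHAPE: `[ψ, Λ']_β = [ψ, (Λ')_B]_β`.**  For `ψ` measurable, left-`N(𝔸)`- and left-`B(F)`-invariant, `Λ'` measurable and left-`B(F)`-invariant, with `∫⁻ β ‖ψ · conj Λ'‖ < ∞`:
`∫ (β g).toReal • (ψ g · conj (Λ' g)) dν_G = ∫ (β g).toReal • (ψ g · conj ((Λ')_B g)) dν_G` — §2 for `F = ψ · conj Λ'` and §3.  This discharges the named input `hAVG` of ★
`K2E1MaassSelbergFourBrackets.integral_weight_psi_mul_conj_eq_four_brackets` ∕ ★ `K2E1MaassSelbergU.maassSelberg_inner_truncation_three`.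
[cite: MoeglinWaldspurger1995, II.1.8] [cite: Garrett2018, §1.10–1.11] -/
theorem integral_wt_smul_mul_conj_eq_mul_conj_borelConstantTerm_of
    (νG : Measure (quasiSplit F E c N).Adelic) [νG.IsHaarMeasure]
    (νN : Measure ↥(adelicUnipotent F E c N)) [νN.IsHaarMeasure] [νN.IsInvInvariant]
    (hconj : ∀ b₀ (hb₀ : b₀ ∈ borelU (c : E →+* E) ((StdForm.antidiagonal N).over E)),
      νN.map (fun v : ↥(adelicUnipotent F E c N) => (⟨((quasiSplit F E c N).toAdelic b₀)⁻¹ * (v : (quasiSplit F E c N).Adelic) * (quasiSplit F E c N).toAdelic b₀,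
        conj_mem_adelicUnipotent ((K2E1PseudoEisensteinConstantTermU.toAdelic_mem_borelAdelic_iff b₀).2 hb₀) v.2⟩ : ↥(adelicUnipotent F E c N))) = νN)
    {𝓕 : Set ↥(adelicUnipotent F E c N)} (h𝓕 : IsFundamentalDomain ↥(rationalUnipotent F E c N) 𝓕 νN) (h𝓕₀ : νN 𝓕 ≠ 0) (h𝓕top : νN 𝓕 ≠ ∞)
    {β : (quasiSplit F E c N).Adelic → ℝ≥0∞} (hβ : IsCoveringWeight ↥((arithmeticBorel F E c N).map (quasiSplit F E c N).arithmeticSubgroup.subtype) β)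
    {ψ Λ' : (quasiSplit F E c N).Adelic → ℂ} (hψm : Measurable ψ) (hΛm : Measurable Λ')
    (hψN : ∀ (u : ↥(adelicUnipotent F E c N)) (g : (quasiSplit F E c N).Adelic), ψ ((u : (quasiSplit F E c N).Adelic) * g) = ψ g)
    (hψB : ∀ b ∈ arithmeticBorel F E c N, ∀ x : (quasiSplit F E c N).Adelic, ψ ((b : (quasiSplit F E c N).Adelic) * x) = ψ x)
    (hΛB : ∀ b ∈ arithmeticBorel F E c N, ∀ x : (quasiSplit F E c N).Adelic, Λ' ((b : (quasiSplit F E c N).Adelic) * x) = Λ' x)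
    (hL1 : ∫⁻ g, β g * ‖ψ g * (starRingEnd ℂ) (Λ' g)‖ₑ ∂νG < ∞) :
    ∫ g, (β g).toReal • (ψ g * (starRingEnd ℂ) (Λ' g)) ∂νG =
      ∫ g, (β g).toReal • (ψ g * (starRingEnd ℂ) (borelConstantTerm νN 𝓕 Λ' g)) ∂νG := by
  have h := integral_wt_smul_borelConstantTerm_eq_of νG νN hconj h𝓕 h𝓕₀ h𝓕top hβ (Fn := fun y => ψ y * (starRingEnd ℂ) (Λ' y))
    (hψm.mul (Complex.continuous_conj.measurable.comp hΛm)) (fun b hb x => by simp only [hψB b hb x, hΛB b hb x]) hL1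
  rw [← h]
  refine integral_congr_ae (ae_of_all _ fun g => ?_)
  simp only [borelConstantTerm_mul_conj_of_unipotent_invariant νN 𝓕 hψN g]

end Generic

/-! ## §4 The instances `U(J₃)`, `U(J₂)` (`hconj` by the product formula ★ p857500) -/

/-- **`U(J₃)`: `[ψ, Λ']_β = [ψ, (Λ')_B]_β`** for `c² = 1`, `c ≠ 1` — `hconj` discharged by ★ `map_conj_toAdelic_eq_self_three`. [cite: MoeglinWaldspurger1995, II.1.8] [cite: Garrett2018, §1.10–1.11] -/
theorem integral_wt_smul_mul_conj_eq_mul_conj_borelConstantTerm_three (hc : c * c = 1) (hc1 : c ≠ 1)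
    [MeasurableSpace (quasiSplit F E c 3).Adelic] [BorelSpace (quasiSplit F E c 3).Adelic]
    (νG : Measure (quasiSplit F E c 3).Adelic) [νG.IsHaarMeasure]
    (νN : Measure ↥(adelicUnipotent F E c 3)) [νN.IsHaarMeasure] [νN.IsInvInvariant]
    {𝓕 : Set ↥(adelicUnipotent F E c 3)} (h𝓕 : IsFundamentalDomain ↥(rationalUnipotent F E c 3) 𝓕 νN) (h𝓕₀ : νN 𝓕 ≠ 0) (h𝓕top : νN 𝓕 ≠ ∞)
    {β : (quasiSplit F E c 3).Adelic → ℝ≥0∞} (hβ : IsCoveringWeight ↥((arithmeticBorel F E c 3).map (quasiSplit F E c 3).arithmeticSubgroup.subtype) β)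
    {ψ Λ' : (quasiSplit F E c 3).Adelic → ℂ} (hψm : Measurable ψ) (hΛm : Measurable Λ')
    (hψN : ∀ (u : ↥(adelicUnipotent F E c 3)) (g : (quasiSplit F E c 3).Adelic), ψ ((u : (quasiSplit F E c 3).Adelic) * g) = ψ g)
    (hψB : ∀ b ∈ arithmeticBorel F E c 3, ∀ x : (quasiSplit F E c 3).Adelic, ψ ((b : (quasiSplit F E c 3).Adelic) * x) = ψ x)
    (hΛB : ∀ b ∈ arithmeticBorel F E c 3, ∀ x : (quasiSplit F E c 3).Adelic, Λ' ((b : (quasiSplit F E c 3).Adelic) * x) = Λ' x)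
    (hL1 : ∫⁻ g, β g * ‖ψ g * (starRingEnd ℂ) (Λ' g)‖ₑ ∂νG < ∞) :
    ∫ g, (β g).toReal • (ψ g * (starRingEnd ℂ) (Λ' g)) ∂νG =
      ∫ g, (β g).toReal • (ψ g * (starRingEnd ℂ) (borelConstantTerm νN 𝓕 Λ' g)) ∂νG :=
  integral_wt_smul_mul_conj_eq_mul_conj_borelConstantTerm_of νG νN (fun _ hb₀ => map_conj_toAdelic_eq_self_three hc hc1 νN hb₀)
    h𝓕 h𝓕₀ h𝓕top hβ hψm hΛm hψN hψB hΛB hL1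

/-- **`U(J₃)`: `∫ (β g) • F_B dν_G = ∫ (β g) • F dν_G`** for left-`B(F)`-invariant `F` (`c² = 1`, `c ≠ 1`). [cite: MoeglinWaldspurger1995, II.1.8] [cite: Garrett2018, §1.10] -/
theorem integral_wt_smul_borelConstantTerm_eq_three (hc : c * c = 1) (hc1 : c ≠ 1)
    [MeasurableSpace (quasiSplit F E c 3).Adelic] [BorelSpace (quasiSplit F E c 3).Adelic]
    (νG : Measure (quasiSplit F E c 3).Adelic) [νG.IsHaarMeasure]
    (νN : Measure ↥(adelicUnipotent F E c 3)) [νN.IsHaarMeasure] [νN.IsInvInvariant]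
    {𝓕 : Set ↥(adelicUnipotent F E c 3)} (h𝓕 : IsFundamentalDomain ↥(rationalUnipotent F E c 3) 𝓕 νN) (h𝓕₀ : νN 𝓕 ≠ 0) (h𝓕top : νN 𝓕 ≠ ∞)
    {β : (quasiSplit F E c 3).Adelic → ℝ≥0∞} (hβ : IsCoveringWeight ↥((arithmeticBorel F E c 3).map (quasiSplit F E c 3).arithmeticSubgroup.subtype) β)
    {Fn : (quasiSplit F E c 3).Adelic → ℂ} (hFm : Measurable Fn)
    (hFB : ∀ b ∈ arithmeticBorel F E c 3, ∀ x : (quasiSplit F E c 3).Adelic, Fn ((b : (quasiSplit F E c 3).Adelic) * x) = Fn x)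
    (hL1 : ∫⁻ g, β g * ‖Fn g‖ₑ ∂νG < ∞) :
    ∫ g, (β g).toReal • borelConstantTerm νN 𝓕 Fn g ∂νG = ∫ g, (β g).toReal • Fn g ∂νG :=
  integral_wt_smul_borelConstantTerm_eq_of νG νN (fun _ hb₀ => map_conj_toAdelic_eq_self_three hc hc1 νN hb₀) h𝓕 h𝓕₀ h𝓕top hβ hFm hFB hL1

/-- **`U(J₂)`: `[ψ, Λ']_β = [ψ, (Λ')_B]_β`** for `c² = 1`, `c ≠ 1` — `hconj` discharged by ★ `map_conj_toAdelic_eq_self_two`. [cite: MoeglinWaldspurger1995, II.1.8] [cite: Garrett2018, §1.10–1.11] -/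
theorem integral_wt_smul_mul_conj_eq_mul_conj_borelConstantTerm_two (hc : c * c = 1) (hc1 : c ≠ 1)
    [MeasurableSpace (quasiSplit F E c 2).Adelic] [BorelSpace (quasiSplit F E c 2).Adelic]
    (νG : Measure (quasiSplit F E c 2).Adelic) [νG.IsHaarMeasure]
    (νN : Measure ↥(adelicUnipotent F E c 2)) [νN.IsHaarMeasure] [νN.IsInvInvariant]
    {𝓕 : Set ↥(adelicUnipotent F E c 2)} (h𝓕 : IsFundamentalDomain ↥(rationalUnipotent F E c 2) 𝓕 νN) (h𝓕₀ : νN 𝓕 ≠ 0) (h𝓕top : νN 𝓕 ≠ ∞)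
    {β : (quasiSplit F E c 2).Adelic → ℝ≥0∞} (hβ : IsCoveringWeight ↥((arithmeticBorel F E c 2).map (quasiSplit F E c 2).arithmeticSubgroup.subtype) β)
    {ψ Λ' : (quasiSplit F E c 2).Adelic → ℂ} (hψm : Measurable ψ) (hΛm : Measurable Λ')
    (hψN : ∀ (u : ↥(adelicUnipotent F E c 2)) (g : (quasiSplit F E c 2).Adelic), ψ ((u : (quasiSplit F E c 2).Adelic) * g) = ψ g)
    (hψB : ∀ b ∈ arithmeticBorel F E c 2, ∀ x : (quasiSplit F E c 2).Adelic, ψ ((b : (quasiSplit F E c 2).Adelic) * x) = ψ x)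
    (hΛB : ∀ b ∈ arithmeticBorel F E c 2, ∀ x : (quasiSplit F E c 2).Adelic, Λ' ((b : (quasiSplit F E c 2).Adelic) * x) = Λ' x)
    (hL1 : ∫⁻ g, β g * ‖ψ g * (starRingEnd ℂ) (Λ' g)‖ₑ ∂νG < ∞) :
    ∫ g, (β g).toReal • (ψ g * (starRingEnd ℂ) (Λ' g)) ∂νG =
      ∫ g, (β g).toReal • (ψ g * (starRingEnd ℂ) (borelConstantTerm νN 𝓕 Λ' g)) ∂νG :=
  integral_wt_smul_mul_conj_eq_mul_conj_borelConstantTerm_of νG νN (fun _ hb₀ => map_conj_toAdelic_eq_self_two hc hc1 νN hb₀)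
    h𝓕 h𝓕₀ h𝓕top hβ hψm hΛm hψN hψB hΛB hL1

end Summit.HodgeConjecture.HodgeConjecture.Cruxes.H413.K2E1BorelWeightAverage

end
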